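import Summits.AtomisticToContinuum.HydrodynamicLimit.Theorems.LambertianContactSwapSwapGapRelEntBudget
import HarnessLib

/-!
# `SwapGap` (stmt-AtomisticToContinuum-11850), line `Sketch`: the registered stub S1dec `stub_relEntDecomposition`

Helper file (`--supports`) closing the registered stub S1dec of the reshaped skeleton `Cruxes/SwapGap/Lines/Sketch.lean`
(sha 92687f7f) by the landed theorem `…SwapGapRelEntBudget.klDiv_map_flow_map_lambertFlow_decomposition` (conjuncts 1, 5, 6):
granted the `Λ`-invariance of `liouville ⊗ γ^ℕ`, for continuous profiles, `0 < σ < 1/2`, every `N`, `Φ`, `t ≥ 0`,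
`KL(p_t ‖ q_t) < ∞`, `KL(p_t ‖ q_t) = KL(P_N ‖ G_N) − ∫ llr q_t G_N dp_t` and `KL(q_t ‖ G_N) = ∫ llr q_t G_N dq_t` in `ℝ`.
prover-line-stmt-AtomisticToContinuum-11850-c1-0 (line lead c1).
-/

noncomputable section

open MeasureTheory Filter Set Topology InformationTheory
open scoped ENNReal

namespace Summit.AtomisticToContinuum.HydrodynamicLimit.Theorems.LambertianContactSwapSwapGapStubRelEntDecomposition

open Literature.Analysis.FluidPDE Literature.MathematicalPhysics.KineticTheory
open Summit.AtomisticToContinuum.HydrodynamicLimit.Theorems.LambertianContactSwapSwapGapRelEntBudget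

/-- Registered stub S1dec `stub_relEntDecomposition` of line `Sketch` (crux stmt-AtomisticToContinuum-11850), verbatim
signature, closed by `klDiv_map_flow_map_lambertFlow_decomposition`. [cite: KipnisLandim1999, Ch. 6 §1] -/
theorem stub_relEntDecomposition :
    (∀ ε : ℝ, 0 < ε → ε < 2⁻¹ → ∀ (N : ℕ) (t : ℝ), 0 ≤ t →
      ((liouville (Torus.geometry (Fin 3)) N ε).prod (lambertNoise (Fin 3))).map
          (fun p => lambertFlow (Torus.geometry (Fin 3)) ε p.2 p.1 t) =
        liouville (Torus.geometry (Fin 3)) N ε) →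
    ∀ (a₀ θ₀ : T3 → ℝ) (u₀ : T3 → V3), Continuous a₀ → Continuous θ₀ → Continuous u₀ →
      (∀ x, 0 < a₀ x) → (∀ x, 0 < θ₀ x) → ∀ σ : ℝ, 0 < σ → σ < 2⁻¹ →
      ∀ (N : ℕ) (Φ : HardSphereFlow (Torus.geometry (Fin 3)) (hsDiameter σ N) (N + 1)) (t : ℝ),
        0 ≤ t →
        klDiv ((localGibbsLaw σ a₀ u₀ θ₀ N Φ).map (Φ.flow t))
            (((localGibbsLaw σ a₀ u₀ θ₀ N Φ).prod (lambertNoise (Fin 3))).map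
              (fun p => lambertFlow (Torus.geometry (Fin 3)) (hsDiameter σ N) p.2 p.1 t)) ≠ ∞ ∧
        (klDiv ((localGibbsLaw σ a₀ u₀ θ₀ N Φ).map (Φ.flow t))
            (((localGibbsLaw σ a₀ u₀ θ₀ N Φ).prod (lambertNoise (Fin 3))).map
              (fun p => lambertFlow (Torus.geometry (Fin 3)) (hsDiameter σ N) p.2 p.1 t))).toReal =
          (klDiv (localGibbsLaw σ a₀ u₀ θ₀ N Φ)
              (localGibbsLaw σ (fun _ => 1) (fun _ => 0) (fun _ => 1) N Φ)).toReal -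
            ∫ z, llr (((localGibbsLaw σ a₀ u₀ θ₀ N Φ).prod (lambertNoise (Fin 3))).map
                (fun p => lambertFlow (Torus.geometry (Fin 3)) (hsDiameter σ N) p.2 p.1 t))
              (localGibbsLaw σ (fun _ => 1) (fun _ => 0) (fun _ => 1) N Φ) z
              ∂((localGibbsLaw σ a₀ u₀ θ₀ N Φ).map (Φ.flow t)) ∧
        (klDiv (((localGibbsLaw σ a₀ u₀ θ₀ N Φ).prod (lambertNoise (Fin 3))).map
              (fun p => lambertFlow (Torus.geometry (Fin 3)) (hsDiameter σ N) p.2 p.1 t))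
            (localGibbsLaw σ (fun _ => 1) (fun _ => 0) (fun _ => 1) N Φ)).toReal =
          ∫ z, llr (((localGibbsLaw σ a₀ u₀ θ₀ N Φ).prod (lambertNoise (Fin 3))).map
                (fun p => lambertFlow (Torus.geometry (Fin 3)) (hsDiameter σ N) p.2 p.1 t))
              (localGibbsLaw σ (fun _ => 1) (fun _ => 0) (fun _ => 1) N Φ) z
              ∂(((localGibbsLaw σ a₀ u₀ θ₀ N Φ).prod (lambertNoise (Fin 3))).map
                (fun p => lambertFlow (Torus.geometry (Fin 3)) (hsDiameter σ N) p.2 p.1 t)) := by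
  intro hLI a₀ θ₀ u₀ ha hθ hu ha0 hθ0 σ hσ hσ' N Φ t ht
  obtain ⟨A, b, -, -, h⟩ := klDiv_map_flow_map_lambertFlow_decomposition hLI ha hθ hu ha0 hθ0 hσ hσ'
  obtain ⟨h1, -, -, -, h5, h6, -, -⟩ := h N Φ t ht
  exact ⟨h1, h5, h6⟩

end Summit.AtomisticToContinuum.HydrodynamicLimit.Theorems.LambertianContactSwapSwapGapStubRelEntDecomposition

end
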